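import Summits.BirchSwinnertonDyer.Rank1Residual.O5.HeegnerLogTransportThreeResidual
import Summits.BirchSwinnertonDyer.Rank1Residual.O5.HeegnerLogTransportThreeOrdTwist
import HarnessLib
import HarnessLib.Audit.Tags

/-!
# Heegner-log transport at `p = 3` (KL3), part 7 (END): the three KL3-C♭ assemblies WITHOUT the KL3-M binder — o5-r2 GEN 20

HONEST FRAMING (cell `b2b-bsdres`, run/shared/lean/b2b/bsd-rank1-residual/, verbatim in every file): the
goal of the cell is to DELETE the COMBINATION-SHAPED residual classes of the Birch–Swinnerton-Dyer formula
for ALL analytic-rank `≤ 1` elliptic curves over `ℚ` — "full BSD formula for every rank `≤ 1` curve in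
class `C`" assembled STRICTLY from published theorems — so that the rank-`≤ 1` remainder becomes exactly
the CONSTRUCTION-SHAPED classes, which are TYPED (missing-input `Prop`s), NOT attempted. This is not
"finishing BSD". Team O5 (tame potentially supersingular additive `p = 3`, (t′)), planner o5-r2 (the
non-Iwasawa side), GEN 20; RESEARCH ROUTE; THEOREMS ONLY (bookkeeping over explicit hypotheses): no new
node is WANTED, no Literature fact, no `@[conjecture]`, no new object; NOTHING is booked and no mark of
`RESIDUAL-MAP.md` moves. O5 OPEN.

## What this file records (GEN 19 docket (b); memo `HOME/b2b-bsdres-o5-r2/gen20/O5-GEN20.md`)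

Part 7 (`O5/HeegnerLogTransportThreeResidual.lean`, same generation) PROVES KL3-M at every DEGREE-ONE prime
`𝔭 ∣ 3` (`residualSelmerMatchingThreeDegOne_holds`; applied form `natCard_selmerAcBase_eq_one_iff_companion`).
Every END of the KL3 chain works at such a `𝔭` (binders `he : e(𝔭|3) = 1`, `hf : f(𝔭|3) = 1`, needed for
`embAt`), so the binder `hM : ResidualSelmerMatchingThree` of

* GEN 18's `o5_index_unit_of_good_companion_selmer` and `o5_index_unit_of_goodOrd_companion_selmer`
  (part 5, `O5/HeegnerLogTransportThreeOrdSelmerIndex.lean`), and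
* GEN 19's END `o5_index_unit_of_ordinary_companion` (part 6, `O5/HeegnerLogTransportThreeOrdTwist.lean`)

is DELETED here: the three theorems below are those three VERBATIM (statements and proofs), minus the
binder `hM`, with the single use of `hM` replaced by part 7's theorem. The originals stay in the tree
unchanged (they remain correct and citable; `residualSelmerMatchingThreeDegOne_of` in part 7 records that
the binder-free KL3-M implies the degree-one form).

NET for the KL3 chain after GEN 20 (memo §3): END `o5_index_unit_of_ordinary_companion_residual` — KL3-C♭
at `embAt 𝔭` on the 274/870 C-KL3-V pairs with a good-ordinary companion is a theorem modulo the TYPED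
nodes KL3-A (`KrizLiUnitBitTransportThree`, print: Kriz–Li Thm. 1.16 / Rem. 1.17), KL3-B
(`O5BaseSelmerCountThree`), KL3-G (`GoodBaseSelmerCountThree`, print: Greenberg LNM 1716 §4–5 + CPT), the
named facts (modularity, Gross–Zagier, Kolyvagin, Yan–Zhu 2026 Thm. 4.15, Wuthrich Lemma 20), the per-row
data, and the STEP-0 identity. KL3-M is no longer an input. O5 OPEN; nothing booked.

## TYPER PLACEMENT NOTE

Place AFTER part 7 (`O5/HeegnerLogTransportThreeResidual.lean`), which this file imports; both files are
THEOREMS only in namespace `Summit.BirchSwinnertonDyer.Rank1Residual.O5.HeegnerLogTransport`; no `def`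
here. Checked by o5-r2 against the GEN 20 draft of part 7 (concatenated scratch, `lean check` rc 0,
0 sorries, 0 warnings).

## TYPER PLACEMENT NOTE (cc-typer-5 GEN 18 = O5 §3.5 / O6 §3.4 typer of record; by-name ask A-O5-G20-1 of o5-r2 GEN 20, HOME/INBOX.md l.13845:
'place by sha, the same way as A-O5-G18-1 / A-O5-G19-1, TWO files IN ORDER … over 400 l. — if your lane splits …')

Source (ii): `HOME/b2b-bsdres-o5-r2/gen20/lean/HeegnerLogTransportThreeResidualEnd.lean` sha16 `66f8321abda17dec` (292 l.; o5-r2's concatenated scratch with (i) rc 0 / 0 warnings),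
re-hashed by the typer; THIS file = source (ii) VERBATIM + this paragraph (its line-1 import `…O5.HeegnerLogTransportThreeResidual` = the typer's §4–§6 file of part (i),
line 2 = part 6 `…OrdTwist` p346273).  THEOREMS ONLY (0 def / 0 `@[conjecture]` / 0 facts / no `sorry`): GEN 18's `o5_index_unit_of_good_companion_selmer` /
`o5_index_unit_of_goodOrd_companion_selmer` (p345686) and GEN 19's END `o5_index_unit_of_ordinary_companion` (p346273) re-assembled by the planner WITHOUT the binder
`(hM : ResidualSelmerMatchingThree)` (names suffixed `_residual`; KL3-M discharged by `natCard_selmerAcBase_eq_one_iff_companion`); the originals stay untouched in their files.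
Farm: joint Engine+Residual+End rc 0 / 0 warnings; axioms of `o5_index_unit_of_ordinary_companion_residual` {propext, Classical.choice, Quot.sound}.
KL3 parts 1–6: `O5/HeegnerLogTransportThree{,Chain,Targets,Global}.lean` (p340741 / p341262 / p341640 / p342632), `…OrdCompanion{,Index}.lean` (p343587 / p344465),
`…OrdSelmer{,Index}.lean` (p345030 / p345686), `…OrdTwist.lean` (p346273); Literature index lemma p344022.  HONEST FRAMING (cell `b2b-bsdres`): research route, lane
CLASS-CLOSURE §3.5 O5; nothing asserted beyond the displayed binders, nothing booked, no mark of `RESIDUAL-MAP.md` moves; census = EVIDENCE, never a Literature fact; O5 OPEN.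
-/

set_option autoImplicit false

noncomputable section

open scoped Classical

open WeierstrassCurve Literature.NumberTheory.EllipticCurves
  Literature.NumberTheory.EllipticCurves.ModularForms
  Literature.NumberTheory.EllipticCurves.Rank1Residual
  Literature.NumberTheory.EllipticCurves.Rank1Residual.Typed

namespace Summit.BirchSwinnertonDyer.Rank1Residual.O5.HeegnerLogTransport

open Summit.BirchSwinnertonDyer.Rank1Residual.X11b (padicLogOrd embAt padicPointOf index_zmultiples_zsmul)
open Summit.BirchSwinnertonDyer.Rank1Residual.X11b.LocalIndex (psi
  exists_addEquiv_valuation_psi_padicPointOf valuation_psi_zsmul_add)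
open Literature.NumberTheory.EllipticCurves.Rank1Residual (Addv)
open Summit.BirchSwinnertonDyer.Rank1Residual.Additive.LocalLog (reductionPointCount_of_addv)
open Summit.BirchSwinnertonDyer.Rank1Residual.X11b.AcSelmer (selmerAcBase)
open IsDedekindDomain (HeightOneSpectrum)
open scoped NumberField

/-! ## §1 GEN 18's good-companion assembly without `hM` -/

/-- **KL3-C♭ (read at `ι₃ = embAt 𝔭`) on a companion GOOD at `3` whose Heegner pair satisfies BSD₃ — modulo
KL3-A/B/G only.** Verbatim GEN 18's `o5_index_unit_of_good_companion_selmer` (part 5,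
`O5/HeegnerLogTransportThreeOrdSelmerIndex.lean`) with the binder `hM : ResidualSelmerMatchingThree` (KL3-M)
DELETED: the one use `(hM W G hρ hcong ht3 htℓ K hK hHWG 𝔭 h𝔭).mp hSelW` is now the THEOREM
`natCard_selmerAcBase_eq_one_iff_companion … 𝔭 h𝔭 he hf` of part 7 (the END already holds the degree-one
binders `he`, `hf`). All other binders and the proof are unchanged. [cite: KrizLi2019, Thm. 1.16, Rem. 1.17]
[cite: JetchevSkinnerWan2017, Prop. 3.2.1 and (7.1.5)] [cite: GreenbergLNM1716, §3 Lemma 3.3 (p. 87) and §5 p. 114] -/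
theorem o5_index_unit_of_good_companion_selmer_residual
    (hA : KrizLiUnitBitTransportThree) (hB : O5BaseSelmerCountThree)
    (hG : GoodBaseSelmerCountThree)
    (W G : WeierstrassCurve ℚ) [W.IsElliptic] [W.IsGloballyMinimal] [G.IsElliptic] [G.IsGloballyMinimal]
    (hcong : ∀ ℓ : ℕ, ℓ.Prime → ¬ (ℓ ∣ 3 * W.conductorNorm ℤ * G.conductorNorm ℤ) →
      ((W.LFunction ℓ : ℤ) : ZMod 3) = ((G.LFunction ℓ : ℤ) : ZMod 3))
    (hρ : W.HasSurjectiveModNGaloisRep 3) (hadd : Addv W 3) (hj : 0 ≤ padicValRat 3 W.j)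
    (hf₂ : Additive.CondExpTwo W 3) (hWa3 : W.LFunction 3 = 0) (ht3 : NoLocalThreeTorsionAt W 3)
    (htℓ : ∀ (ℓ : ℕ) [Fact ℓ.Prime], ℓ ≠ 3 → (ℓ : ℤ) ∣ W.conductorNorm ℤ * G.conductorNorm ℤ →
      NoLocalThreeTorsionAt W ℓ)
    (hNW : W.conductorNorm ℤ ≠ 0) (hNG : G.conductorNorm ℤ ≠ 0)
    (hunitW : ∀ ℓ ∈ klSet W G, ℓ ≠ 3 → padicValInt 3 (nsCount W ℓ) = 0)
    (hunitG : ∀ ℓ ∈ klSet G W, ℓ ≠ 3 → padicValInt 3 (nsCount G ℓ) = 0)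
    (htam : ¬ 3 ∣ W.tamagawaProduct) (htamG : ¬ 3 ∣ G.tamagawaProduct)
    (hgoodG : G.HasGoodReductionAtPrime 3)
    (Gd : WeierstrassCurve ℚ) [Gd.IsElliptic] (hfinG : Finite G.sha) (hfinGd : Finite Gd.sha)
    (hMG : MissingPPartAt G 3) (hMGd : MissingPPartAt Gd 3)
    {N N' : ℕ} [NeZero N] [NeZero N'] (D : ModularParametrizationData W N)
    (D' : ModularParametrizationData G N')
    (K : Type) [Field K] [NumberField K] (hK : IsImaginaryQuadratic K)
    (hH : SatisfiesHeegnerHypothesis N K) (hH' : SatisfiesHeegnerHypothesis N' K)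
    (hHWG : SatisfiesHeegnerHypothesis (W.conductorNorm ℤ * G.conductorNorm ℤ) K)
    (hKoW : kolyvagin N W K) (hKoG : kolyvagin N' G K)
    (hd : NumberField.discr K < -4) (h3d : ¬ ((3 : ℤ) ∣ NumberField.discr K))
    (hGd : ∃ C : VariableChange ℚ, C • G.quadraticTwist (NumberField.discr K : ℚ) = Gd)
    (H : HeegnerDatum N (NumberField.discr K)) (H' : HeegnerDatum N' (NumberField.discr K))
    (ι : K →+* ℂ) (𝔭 : HeightOneSpectrum (𝓞 K)) (h𝔭 : ((3 : ℕ) : 𝓞 K) ∈ 𝔭.asIdeal)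
    (he : 𝔭.asIdeal.ramificationIdx (𝓞 ℚ) = 1) (hf : 𝔭.asIdeal.inertiaDeg (𝓞 ℚ) = 1)
    (P : (W.baseChange K).toAffine.Point) (P' : (G.baseChange K).toAffine.Point)
    (hP : WeierstrassCurve.Affine.Point.map ι.toRatAlgHom P = heegnerPointComplex D H)
    (hP' : WeierstrassCurve.Affine.Point.map ι.toRatAlgHom P' = heegnerPointComplex D' H')
    (hPinf : ¬ IsOfFinAddOrder P) (hP'inf : ¬ IsOfFinAddOrder P')
    (hshaW : Nat.card (AddCommGroup.primaryComponent (W.baseChange K).sha 3) = 1)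
    (hQW : ∃ Q : (W.baseChange K).toAffine.Point, ¬ IsOfFinAddOrder Q ∧
      padicLogOrd W 3 (embAt K 3 𝔭 h𝔭 he hf) Q = 0)
    (hcD : padicValInt 3 D.maninConstant = 0) (hcD' : padicValInt 3 D'.maninConstant = 0)
    {q₀ q₁ : ℚ} (hq₀ : shaAn G = (q₀ : ℂ)) (hq₁ : shaAn Gd = (q₁ : ℂ))
    (hstep0 : padicValRat 3 q₀ + padicValRat 3 q₁ + ((2 * padicValNat 3 G.tamagawaProduct : ℕ) : ℤ) +
        ((2 * padicValInt 3 D'.maninConstant : ℕ) : ℤ) =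
      ((2 * padicValNat 3 (AddSubgroup.zmultiples P').index : ℕ) : ℤ)) :
    padicValNat 3 (AddSubgroup.zmultiples P).index = 0 := by
  haveI : Finite G.sha := hfinG
  haveI : Finite Gd.sha := hfinGd
  -- W side: `W(K)[3] = 0`, `3 ∤ c₃(W)`, finite index, and L1′
  have htorsW := nsmul_eq_zero_imp_eq_zero_of_surj W K hK (by norm_num) hρ
  have hc3 := not_dvd_localTamagawaNumber_of_not_dvd_tamagawaProduct W htam
  have hI0W : (AddSubgroup.zmultiples P).index ≠ 0 :=
    index_zmultiples_ne_zero_of_isHeegnerPoint N W K hKoW hK hH ⟨D, H, ι, hP⟩ hPinf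
  obtain ⟨Q, hQinf, hQunit⟩ := hQW
  have hlog := padicLogOrd_eq_padicValNat_index_of_logUnit W hadd hc3 htorsW (embAt K 3 𝔭 h𝔭 he hf) P Q
    hPinf hQinf hI0W hQunit
  -- KL3-B: `Sel_𝔭(K, W[3^∞]) = 0`; KL3-M° (THEOREM, part 7): `Sel_𝔭(K, G[3^∞]) = 0`
  have hSelW := selmerAcBase_card_eq_one_of_units hB W hadd hj hf₂ hρ ht3 D K hK hH hd H ι P hP hPinf
    𝔭 h𝔭 he hf hshaW hlog
  have hSelG : Nat.card (selmerAcBase (G.baseChange K) 3 𝔭 ∅) = 1 :=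
    (natCard_selmerAcBase_eq_one_iff_companion W G hρ hcong ht3 htℓ K hK hHWG 𝔭 h𝔭 he hf).mp hSelW
  -- companion-side hypotheses transported along `ρ̄_{G,3} ≅ ρ̄_{W,3}`
  have hirrW : W.HasIrreducibleModPGaloisRep 3 :=
    hasIrreducibleModPGaloisRep_of_hasSurjectiveModNGaloisRep W 3 hρ
  have ht3G : NoLocalThreeTorsionAt G 3 := noLocalThreeTorsionAt_of_isCongruentModThree W G hirrW hcong 3 ht3
  have htorsG := nsmul_eq_zero_imp_eq_zero_of_isCongruentModThree W G hirrW hcong K htorsW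
  haveI : (G.baseChange K).IsElliptic := by rw [WeierstrassCurve.baseChange]; infer_instance
  have hKol := hKoG hK hH' ⟨D', H', ι, hP'⟩ hP'inf
  have hI0G : (AddSubgroup.zmultiples P').index ≠ 0 :=
    index_zmultiples_ne_zero_of_isHeegnerPoint N' G K hKoG hK hH' ⟨D', H', ι, hP'⟩ hP'inf
  -- KL3-G read backwards: `Ш(G/K)[3^∞] = 0` and the KL-normalised log of `P′` has the valuation of the index
  obtain ⟨hshaG, hklG⟩ := sha_trivial_and_klLog_eq_of_selmer_trivial hG G hgoodG ht3G K hK htorsG hKol.1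
    hKol.2 P' hP'inf hI0G 𝔭 h𝔭 he hf hSelG
  -- BSD₃ of the pair `(G, G^{(d_K)})`: `3 ∤ [G(K) : ℤP′]`, so the companion Heegner log is a `3`-adic unit
  obtain ⟨hu₀, hu₁⟩ := padicValRat_shaAn_pair_eq_zero_of_sha_trivial G Gd K hK hGd 3 (by decide) hMG hMGd
    hq₀ hq₁ hshaG
  obtain ⟨hI, -⟩ := padicValNat_index_eq_zero_of_missingPPartAt_pair G Gd K hK hGd 3 (by decide) hMG hMGd
    P' hq₀ hq₁ hstep0 hu₀ hu₁ (padicValNat.eq_zero_of_not_dvd htamG) hcD'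
  have hGunit : padicLogOrd G 3 (embAt K 3 𝔭 h𝔭 he hf) P' + padicValInt 3 (nsCount G 3) - 1 = 0 := by
    rw [hklG, hI, Nat.cast_zero]
  -- KL3-A: the W-side chain of GEN 16
  exact padicValNat_index_eq_zero_of_companion_unit' hA W G hcong hρ hadd hWa3 hNW hNG hunitW hunitG htam
    D D' K hK hH hH' hd h3d H H' ι (embAt K 3 𝔭 h𝔭 he hf) P P' hP hP' hPinf hP'inf hcD hcD' hGunit

/-- **Row C16 plugged in, modulo KL3-A/B/G only**: verbatim GEN 18's
`o5_index_unit_of_goodOrd_companion_selmer` with the binder `hM` (KL3-M) DELETED (part 7 proves it at the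
degree-one `𝔭` the END works at). [cite: YanZhu2024MainConjNonCM, Thm. 4.15 (§4.6)] [cite: KrizLi2019, Thm. 1.16]
[cite: GreenbergLNM1716, §3 Lemma 3.3 (p. 87) and §5 p. 114] -/
theorem o5_index_unit_of_goodOrd_companion_selmer_residual
    (hA : KrizLiUnitBitTransportThree) (hB : O5BaseSelmerCountThree)
    (hG : GoodBaseSelmerCountThree)
    (hYZ : YanZhu2026.thm415_padicValRat_bsd_rank_le_one)
    (hW20 : Wuthrich2014.lemma20_surjective_threeAdic_of_semistable)
    (hmod : hasEntireLFunction_rat) (hGZK : rank_eq_analyticRank_of_analyticRank_le_one)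
    (W G : WeierstrassCurve ℚ) [W.IsElliptic] [W.IsGloballyMinimal] [G.IsElliptic] [G.IsGloballyMinimal]
    (hcong : ∀ ℓ : ℕ, ℓ.Prime → ¬ (ℓ ∣ 3 * W.conductorNorm ℤ * G.conductorNorm ℤ) →
      ((W.LFunction ℓ : ℤ) : ZMod 3) = ((G.LFunction ℓ : ℤ) : ZMod 3))
    (hρ : W.HasSurjectiveModNGaloisRep 3) (hadd : Addv W 3) (hj : 0 ≤ padicValRat 3 W.j)
    (hf₂ : Additive.CondExpTwo W 3) (hWa3 : W.LFunction 3 = 0) (ht3 : NoLocalThreeTorsionAt W 3)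
    (htℓ : ∀ (ℓ : ℕ) [Fact ℓ.Prime], ℓ ≠ 3 → (ℓ : ℤ) ∣ W.conductorNorm ℤ * G.conductorNorm ℤ →
      NoLocalThreeTorsionAt W ℓ)
    (hNW : W.conductorNorm ℤ ≠ 0) (hNG : G.conductorNorm ℤ ≠ 0)
    (hunitW : ∀ ℓ ∈ klSet W G, ℓ ≠ 3 → padicValInt 3 (nsCount W ℓ) = 0)
    (hunitG : ∀ ℓ ∈ klSet G W, ℓ ≠ 3 → padicValInt 3 (nsCount G ℓ) = 0)
    (htam : ¬ 3 ∣ W.tamagawaProduct) (htamG : ¬ 3 ∣ G.tamagawaProduct)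
    (hrG : G.analyticRank ≤ 1) (hC16 : RowC16 G 3)
    (Gd : WeierstrassCurve ℚ) [Gd.IsElliptic] [Gd.IsGloballyMinimal] (hrGd : Gd.analyticRank ≤ 1)
    (hC16d : RowC16 Gd 3)
    {N N' : ℕ} [NeZero N] [NeZero N'] (D : ModularParametrizationData W N)
    (D' : ModularParametrizationData G N')
    (K : Type) [Field K] [NumberField K] (hK : IsImaginaryQuadratic K)
    (hH : SatisfiesHeegnerHypothesis N K) (hH' : SatisfiesHeegnerHypothesis N' K)
    (hHWG : SatisfiesHeegnerHypothesis (W.conductorNorm ℤ * G.conductorNorm ℤ) K)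
    (hKoW : kolyvagin N W K) (hKoG : kolyvagin N' G K)
    (hd : NumberField.discr K < -4) (h3d : ¬ ((3 : ℤ) ∣ NumberField.discr K))
    (hGd : ∃ C : VariableChange ℚ, C • G.quadraticTwist (NumberField.discr K : ℚ) = Gd)
    (H : HeegnerDatum N (NumberField.discr K)) (H' : HeegnerDatum N' (NumberField.discr K))
    (ι : K →+* ℂ) (𝔭 : HeightOneSpectrum (𝓞 K)) (h𝔭 : ((3 : ℕ) : 𝓞 K) ∈ 𝔭.asIdeal)
    (he : 𝔭.asIdeal.ramificationIdx (𝓞 ℚ) = 1) (hf : 𝔭.asIdeal.inertiaDeg (𝓞 ℚ) = 1)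
    (P : (W.baseChange K).toAffine.Point) (P' : (G.baseChange K).toAffine.Point)
    (hP : WeierstrassCurve.Affine.Point.map ι.toRatAlgHom P = heegnerPointComplex D H)
    (hP' : WeierstrassCurve.Affine.Point.map ι.toRatAlgHom P' = heegnerPointComplex D' H')
    (hPinf : ¬ IsOfFinAddOrder P) (hP'inf : ¬ IsOfFinAddOrder P')
    (hshaW : Nat.card (AddCommGroup.primaryComponent (W.baseChange K).sha 3) = 1)
    (hQW : ∃ Q : (W.baseChange K).toAffine.Point, ¬ IsOfFinAddOrder Q ∧
      padicLogOrd W 3 (embAt K 3 𝔭 h𝔭 he hf) Q = 0)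
    (hcD : padicValInt 3 D.maninConstant = 0) (hcD' : padicValInt 3 D'.maninConstant = 0)
    {q₀ q₁ : ℚ} (hq₀ : shaAn G = (q₀ : ℂ)) (hq₁ : shaAn Gd = (q₁ : ℂ))
    (hstep0 : padicValRat 3 q₀ + padicValRat 3 q₁ + ((2 * padicValNat 3 G.tamagawaProduct : ℕ) : ℤ) +
        ((2 * padicValInt 3 D'.maninConstant : ℕ) : ℤ) =
      ((2 * padicValNat 3 (AddSubgroup.zmultiples P').index : ℕ) : ℤ)) :
    padicValNat 3 (AddSubgroup.zmultiples P).index = 0 := by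
  haveI : Finite G.sha := (hGZK G hrG).2
  haveI : Finite Gd.sha := (hGZK Gd hrGd).2
  have hMG : MissingPPartAt G 3 := missingPPartAt_of_bsdp G 3 (RowC16.bsdp hYZ hW20 hmod hGZK hrG hC16)
  have hMGd : MissingPPartAt Gd 3 :=
    missingPPartAt_of_bsdp Gd 3 (RowC16.bsdp hYZ hW20 hmod hGZK hrGd hC16d)
  exact o5_index_unit_of_good_companion_selmer_residual hA hB hG W G hcong hρ hadd hj hf₂ hWa3 ht3 htℓ hNW hNG
    hunitW hunitG htam htamG hC16.2.1.1 Gd ‹Finite G.sha› ‹Finite Gd.sha› hMG hMGd D D' K hK hH hH' hHWG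
    hKoW hKoG hd h3d hGd H H' ι 𝔭 h𝔭 he hf P P' hP hP' hPinf hP'inf hshaW hQW hcD hcD' hq₀ hq₁ hstep0

/-! ## §2 GEN 19's END without `hM` — the END of GEN 20 -/

/-- **END of o5-r2 GEN 20 — KL3-C♭ (read at `ι₃ = embAt 𝔭`) on a good-ORDINARY companion, modulo KL3-A/B/G,
row-C16 decoration discharged (GEN 19) AND KL3-M discharged (GEN 20).** Verbatim GEN 19's
`o5_index_unit_of_ordinary_companion` (part 6, `O5/HeegnerLogTransportThreeOrdTwist.lean`) with the binder
`hM : ResidualSelmerMatchingThree` DELETED. The remaining typed / named inputs: `hA` KL3-A (Kriz–Li unit-bit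
transport, print), `hB` KL3-B (`O5BaseSelmerCountThree`), `hG` KL3-G (`GoodBaseSelmerCountThree`, print:
Greenberg §4–5 + Cassels–Poitou–Tate), `hYZ` (Yan–Zhu 2026 Thm. 4.15), `hW20` (Wuthrich Lemma 20), `hmod`
(modularity), `hGZK`/`hGZG` (Gross–Zagier–Kolyvagin), `hKoW`/`hKoG` (Kolyvagin), the per-row data, and the STEP-0
identity `hstep0`. [cite: YanZhu2024MainConjNonCM, Thm. 4.15 (§4.6)] [cite: KrizLi2019, Thm. 1.16, Rem. 1.17]
[cite: JetchevSkinnerWan2017, Prop. 3.2.1 and (7.1.5)] [cite: GrossZagier1986, Thm. I.6.3 with V.§2]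
[cite: GreenbergLNM1716, §3 Lemma 3.3 (p. 87) and §5 p. 114] -/
theorem o5_index_unit_of_ordinary_companion_residual
    (hA : KrizLiUnitBitTransportThree) (hB : O5BaseSelmerCountThree)
    (hG : GoodBaseSelmerCountThree)
    (hYZ : YanZhu2026.thm415_padicValRat_bsd_rank_le_one)
    (hW20 : Wuthrich2014.lemma20_surjective_threeAdic_of_semistable)
    (hmod : exists_isNewformOf) (hGZK : rank_eq_analyticRank_of_analyticRank_le_one)
    (W G : WeierstrassCurve ℚ) [W.IsElliptic] [W.IsGloballyMinimal] [G.IsElliptic] [G.IsGloballyMinimal]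
    (hcong : ∀ ℓ : ℕ, ℓ.Prime → ¬ (ℓ ∣ 3 * W.conductorNorm ℤ * G.conductorNorm ℤ) →
      ((W.LFunction ℓ : ℤ) : ZMod 3) = ((G.LFunction ℓ : ℤ) : ZMod 3))
    (hρ : W.HasSurjectiveModNGaloisRep 3) (hadd : Addv W 3) (hj : 0 ≤ padicValRat 3 W.j)
    (hf₂ : Additive.CondExpTwo W 3) (ht3 : NoLocalThreeTorsionAt W 3)
    (htℓ : ∀ (ℓ : ℕ) [Fact ℓ.Prime], ℓ ≠ 3 → (ℓ : ℤ) ∣ W.conductorNorm ℤ * G.conductorNorm ℤ →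
      NoLocalThreeTorsionAt W ℓ)
    (hunitW : ∀ ℓ ∈ klSet W G, ℓ ≠ 3 → padicValInt 3 (nsCount W ℓ) = 0)
    (hunitG : ∀ ℓ ∈ klSet G W, ℓ ≠ 3 → padicValInt 3 (nsCount G ℓ) = 0)
    (htam : ¬ 3 ∣ W.tamagawaProduct) (htamG : ¬ 3 ∣ G.tamagawaProduct) (hordG : GoodOrd G 3)
    (Gd : WeierstrassCurve ℚ) [Gd.IsElliptic] [Gd.IsGloballyMinimal]
    {N N' : ℕ} [NeZero N] [NeZero N'] (D : ModularParametrizationData W N)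
    (D' : ModularParametrizationData G N')
    (K : Type) [Field K] [NumberField K] (hK : IsImaginaryQuadratic K)
    (hH : SatisfiesHeegnerHypothesis N K) (hH' : SatisfiesHeegnerHypothesis N' K)
    (hKoW : kolyvagin N W K) (hKoG : kolyvagin N' G K) (hGZG : gross_zagier N' G K)
    (hd : NumberField.discr K < -4) (h3d : ¬ ((3 : ℤ) ∣ NumberField.discr K))
    (hGd : ∃ C : VariableChange ℚ, C • G.quadraticTwist (NumberField.discr K : ℚ) = Gd)
    (H : HeegnerDatum N (NumberField.discr K)) (H' : HeegnerDatum N' (NumberField.discr K))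
    (ι : K →+* ℂ) (𝔭 : HeightOneSpectrum (𝓞 K)) (h𝔭 : ((3 : ℕ) : 𝓞 K) ∈ 𝔭.asIdeal)
    (he : 𝔭.asIdeal.ramificationIdx (𝓞 ℚ) = 1) (hf : 𝔭.asIdeal.inertiaDeg (𝓞 ℚ) = 1)
    (P : (W.baseChange K).toAffine.Point) (P' : (G.baseChange K).toAffine.Point)
    (hP : WeierstrassCurve.Affine.Point.map ι.toRatAlgHom P = heegnerPointComplex D H)
    (hP' : WeierstrassCurve.Affine.Point.map ι.toRatAlgHom P' = heegnerPointComplex D' H')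
    (hPinf : ¬ IsOfFinAddOrder P) (hP'inf : ¬ IsOfFinAddOrder P')
    (hshaW : Nat.card (AddCommGroup.primaryComponent (W.baseChange K).sha 3) = 1)
    (hQW : ∃ Q : (W.baseChange K).toAffine.Point, ¬ IsOfFinAddOrder Q ∧
      padicLogOrd W 3 (embAt K 3 𝔭 h𝔭 he hf) Q = 0)
    (hcD : padicValInt 3 D.maninConstant = 0) (hcD' : padicValInt 3 D'.maninConstant = 0)
    {q₀ q₁ : ℚ} (hq₀ : shaAn G = (q₀ : ℂ)) (hq₁ : shaAn Gd = (q₁ : ℂ))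
    (hstep0 : padicValRat 3 q₀ + padicValRat 3 q₁ + ((2 * padicValNat 3 G.tamagawaProduct : ℕ) : ℤ) +
        ((2 * padicValInt 3 D'.maninConstant : ℕ) : ℤ) =
      ((2 * padicValNat 3 (AddSubgroup.zmultiples P').index : ℕ) : ℤ)) :
    padicValNat 3 (AddSubgroup.zmultiples P).index = 0 := by
  -- the class-level discharges of GEN 19
  have hE : hasEntireLFunction_rat := hasEntireLFunction_rat_of_exists_isNewformOf hmod
  have hWa3 : W.LFunction 3 = 0 :=
    W.LFunction_apply_eq_zero_of_not_good_of_not_mult 3 hadd.1 hadd.2 (dvd_refl 3)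
  have hNW : W.conductorNorm ℤ ≠ 0 := (W.conductorNorm_pos_holds).ne'
  have hNG : G.conductorNorm ℤ ≠ 0 := (G.conductorNorm_pos_holds).ne'
  have hN' : N' = G.conductorNorm ℤ :=
    IsNewformOf.level_eq_conductorNorm_of_exists_isNewformOf hmod D'.isNewformOf
  have hHG : SatisfiesHeegnerHypothesis (G.conductorNorm ℤ) K := hN' ▸ hH'
  have hHWG : SatisfiesHeegnerHypothesis (W.conductorNorm ℤ * G.conductorNorm ℤ) K :=
    satisfiesHeegnerHypothesis_conductor_mul_of_level hmod W G D D' K hH hH'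
  -- row C16 for `G` (§1) and for `Gd` (§2)
  have hC16 : RowC16 G 3 := rowC16_three_of_goodOrd_of_isCongruentModThree W G hcong hρ hordG
  have hC16d : RowC16 Gd 3 := rowC16_three_twist_of_heegner G Gd K hK hHG h3d hGd hC16
  -- the analytic ranks of the pair (§3)
  obtain ⟨hrG, hrGd⟩ := analyticRank_pair_le_one_of_heegner_nonTorsion hmod G D' K hK hH' hGZG Gd hGd
    ⟨D', H', ι, hP'⟩ hP'inf
  exact o5_index_unit_of_goodOrd_companion_selmer_residual hA hB hG hYZ hW20 hE hGZK W G hcong hρ hadd hj hf₂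
    hWa3 ht3 htℓ hNW hNG hunitW hunitG htam htamG hrG hC16 Gd hrGd hC16d D D' K hK hH hH' hHWG hKoW hKoG
    hd h3d hGd H H' ι 𝔭 h𝔭 he hf P P' hP hP' hPinf hP'inf hshaW hQW hcD hcD' hq₀ hq₁ hstep0

end Summit.BirchSwinnertonDyer.Rank1Residual.O5.HeegnerLogTransport

end
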